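import Summits.SmoothPoincare4.SmoothPoincare4.Theorems.DottedCircleRasmussenDcrGapStubFriendsH2HF3

/-!
# Helper `helper_modelHandlebody_localHomology_finite` of stub `stub_friendsH2` — part 4: assembly
(item stmt-SmoothPoincare4-16128, route route-SmoothPoincare4-DottedCircleRasmussen)

**`H_q(ℝ⁴ | D_k; ℚ)` is finite-dimensional, `q = 2, 3`** (`D_k = MMSW.modelHandlebody k`): the
registered helper `helper_modelHandlebody_localHomology_finite` of line `mk_friends`, the only
handlebody input of the `H₂`-leaf `stub_friendsH2` (whose reduction to it is the landed
`helper_friendsH2_of_modelHandlebody_localHomology_finite`).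

Assembly of parts 1–3: the time-`T` map of the pushing flow of part 3 followed by the radial
squeeze of part 2 is a continuous self-map `Φ` of `U = B(0, R + 3) ∖ D_k` with values in the open set
`V = B(0, R + 11/4) ∖ closure {guard > 1/2, G_k < 1 + ε}`, whose closure is a compact subset of `U`,
and `Φ` is homotopic to the identity (flow for times `sT`, then the squeeze `S_λ`); part 1
(Wilder's principle, Bredon II.17, and excision into the ball) concludes.

* `FriendsH2.exists_deformation_ball_diff_modelHandlebody` — the deformation datum of `U`;
* `helper_modelHandlebody_localHomology_finite` — the registered helper.

Everything is proved; no definitions, no named facts, no `sorry`.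

## References

* J. Milnor, *Morse theory*, Ann. of Math. Studies 51 (1963), Thm. 3.1. [Milnor1963]
* G. E. Bredon, *Sheaf Theory*, 2nd ed., GTM 170, Springer 1997, §II.17. [Bredon1997]
* A. Hatcher, *Algebraic Topology*, CUP 2002, Thm. 2.16, Thm. 2.20. [HatcherAT2002]
-/

-- the prescribed namespace `Summit.<P>.<Sub>.…` duplicates `SmoothPoincare4` (P = Sub)
set_option linter.dupNamespace false
set_option linter.style.longLine false

noncomputable section

open scoped ContDiff Topology unitInterval
open CategoryTheory Limits Set Function Metric Filter
open Literature.AlgebraicTopology.SingularHomology Literature.Topology.FourManifolds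
open Literature.Topology.FourManifolds.MMSW

namespace Summit.SmoothPoincare4.SmoothPoincare4.Theorems.DcrGap.MkFriends

namespace FriendsH2

/-- **`B(0, R + 3) ∖ D_k` deforms into a relatively compact open subset** (`R = 40(k+1)`): there
are an open `V` with compact closure contained in `U = B(0, R + 3) ∖ D_k` and a continuous self-map
of `U` with values in `V` homotopic to the identity — the pushing flow of Milnor's regular-band
argument (part 3) followed by a radial squeeze (part 2). [cite: Milnor1963, Thm. 3.1] -/
theorem exists_deformation_ball_diff_modelHandlebody (k : ℕ) :
    ∃ (V : Set (EuclideanSpace ℝ (Fin 4)))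
      (Φ : C(↥({y : EuclideanSpace ℝ (Fin 4) | ‖y‖ < 40 * ((k : ℝ) + 1) + 3 ∧ y ∉ modelHandlebody k}),
        ↥({y : EuclideanSpace ℝ (Fin 4) | ‖y‖ < 40 * ((k : ℝ) + 1) + 3 ∧ y ∉ modelHandlebody k}))),
      IsOpen V ∧ IsCompact (closure V) ∧
      closure V ⊆ {y : EuclideanSpace ℝ (Fin 4) | ‖y‖ < 40 * ((k : ℝ) + 1) + 3 ∧ y ∉ modelHandlebody k} ∧
      (∀ x, (Φ x : EuclideanSpace ℝ (Fin 4)) ∈ V) ∧ Φ.Homotopic (ContinuousMap.id _) := by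
  obtain ⟨θ, T, hθc, h0, hT0, hstay, hend⟩ := exists_pushing_flow k
  have hR40 : (40 : ℝ) ≤ 40 * ((k : ℝ) + 1) := by nlinarith [(k.cast_nonneg : (0 : ℝ) ≤ k)]
  set R : ℝ := 40 * ((k : ℝ) + 1) with hR
  set ε : ℝ := 1 / (4 * R) with hε
  have hε0 : 0 < ε := by positivity
  have hεR : ε ≤ 1 / (4 * R) := le_rfl
  set Dk : Set (EuclideanSpace ℝ (Fin 4)) := modelHandlebody k with hDk
  set U : Set (EuclideanSpace ℝ (Fin 4)) := {y | ‖y‖ < R + 3 ∧ y ∉ Dk} with hU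
  have hDkn : ∀ x ∈ Dk, ‖x‖ ≤ R + 1 := fun x hx => DcrGfgmw.norm_le_of_mem_modelHandlebody hx
  -- the squeeze
  set c : ℝ := R + 2 with hc
  have hc0 : 0 < c := by positivity
  set Sq : ℝ × EuclideanSpace ℝ (Fin 4) → EuclideanSpace ℝ (Fin 4) :=
    fun p => if ‖p.2‖ ≤ c then p.2 else (1 - p.1 / 2 + p.1 * c / (2 * ‖p.2‖)) • p.2 with hSq
  have hSqc : Continuous Sq := squeeze_continuous hc0
  have hSq0 : ∀ y, Sq (0, y) = y := fun y => by
    simp only [hSq]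
    split_ifs
    · rfl
    · simp
  have hSqle : ∀ l y, ‖y‖ ≤ c → Sq (l, y) = y := fun l y hy => by simp only [hSq, if_pos hy]
  have hSqnorm : ∀ l, 0 ≤ l → l ≤ 1 → ∀ y, c < ‖y‖ → ‖Sq (l, y)‖ = ‖y‖ - l * (‖y‖ - c) / 2 :=
    fun l hl0 hl1 y hy => by
      simp only [hSq, if_neg (not_le.2 hy)]
      exact norm_squeeze hc0 hl0 hl1 hy.le
  have hSqU : ∀ l, 0 ≤ l → l ≤ 1 → ∀ y ∈ U, Sq (l, y) ∈ U := by
    intro l hl0 hl1 y hy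
    by_cases hyc : ‖y‖ ≤ c
    · rwa [hSqle l y hyc]
    · push Not at hyc
      have hn := hSqnorm l hl0 hl1 y hyc
      have h1 : l * (‖y‖ - c) / 2 ≤ (‖y‖ - c) / 2 := by
        have : l * (‖y‖ - c) ≤ 1 * (‖y‖ - c) := mul_le_mul_of_nonneg_right hl1 (by linarith)
        linarith
      have h2 : 0 ≤ l * (‖y‖ - c) / 2 := by
        have : 0 ≤ l * (‖y‖ - c) := mul_nonneg hl0 (by linarith)
        linarith
      refine ⟨by linarith [hy.1], fun hD => ?_⟩
      have := hDkn _ hD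
      linarith
  -- the target open set `V`
  set P : Set (EuclideanSpace ℝ (Fin 4)) := {y | ∀ j : Fin k, (1 : ℝ) / 2 < holeTerm k j y} ∩
    levelFun k ⁻¹' Iio (1 + ε) with hP
  set P' : Set (EuclideanSpace ℝ (Fin 4)) := {y | ∀ j : Fin k, (1 : ℝ) / 2 ≤ holeTerm k j y} ∩
    levelFun k ⁻¹' Iic (1 + ε) with hP'
  have hPo : IsOpen P :=
    ((continuousOn_levelFun (by norm_num : (0 : ℝ) < 1 / 2)).mono fun y hy j => (hy j).le).isOpen_inter_preimage
      (isOpen_guard (1 / 2)) isOpen_Iio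
  have hP'c : IsClosed P' :=
    (continuousOn_levelFun (by norm_num : (0 : ℝ) < 1 / 2)).preimage_isClosed_of_isClosed
      (isClosed_guard (1 / 2)) isClosed_Iic
  have hPP' : P ⊆ P' := fun y hy =>
    ⟨fun j => (hy.1 j).le, show levelFun k y ≤ 1 + ε from (show levelFun k y < 1 + ε from hy.2).le⟩
  have hclP : closure P ⊆ P' := closure_minimal hPP' hP'c
  have hDkP : Dk ⊆ P := fun y hy =>
    ⟨fun j => lt_of_lt_of_le (by norm_num) (hy.1 j), show levelFun k y < 1 + ε from lt_of_le_of_lt hy.2 (by linarith)⟩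
  have hP'n : ∀ y ∈ P', ‖y‖ < R + 2 := fun y hy =>
    norm_lt_of_levelFun_le (fun j => lt_of_lt_of_le (by norm_num) (hy.1 j))
      (le_trans (show levelFun k y ≤ 1 + ε from hy.2) (by simp only [hε]; linarith))
  set V : Set (EuclideanSpace ℝ (Fin 4)) := {y | ‖y‖ < R + 11 / 4} ∩ (closure P)ᶜ with hV
  have hVo : IsOpen V := (isOpen_lt continuous_norm continuous_const).inter isClosed_closure.isOpen_compl
  have hVU : closure V ⊆ U := by
    intro y hy
    have h1 : y ∈ closure {y : EuclideanSpace ℝ (Fin 4) | ‖y‖ < R + 11 / 4} :=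
      closure_mono inter_subset_left hy
    have h2 : y ∈ closure (closure P)ᶜ := closure_mono inter_subset_right hy
    have h1' : ‖y‖ ≤ R + 11 / 4 := closure_lt_subset_le continuous_norm continuous_const h1
    rw [closure_compl] at h2
    have h2' : y ∉ P := fun h => h2 ((hPo.subset_interior_iff.2 subset_closure) h)
    exact ⟨by linarith, fun h => h2' (hDkP h)⟩
  have hVc : IsCompact (closure V) :=
    Metric.isCompact_of_isClosed_isBounded isClosed_closure
      ((isBounded_closedBall (x := (0 : EuclideanSpace ℝ (Fin 4))) (r := R + 11 / 4)).subset
        (closure_minimal (fun y hy => mem_closedBall_zero_iff.2 (le_of_lt hy.1)) isClosed_closedBall))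
  -- the deformation `Φ = Sq₁ ∘ θ_T`
  have hstayU : ∀ x : U, ∀ t, 0 ≤ t → θ (t, (x : EuclideanSpace ℝ (Fin 4))) ∈ U := fun x t ht =>
    hstay x.1 x.2.1 x.2.2 t ht
  let Φ : C(U, U) :=
    ⟨fun x => ⟨Sq (1, θ (T, (x : EuclideanSpace ℝ (Fin 4)))), hSqU 1 zero_le_one le_rfl _ (hstayU x T hT0)⟩,
      (hSqc.comp (continuous_const.prodMk (hθc.comp (continuous_const.prodMk continuous_subtype_val)))).subtype_mk _⟩
  have hΦV : ∀ x, (Φ x : EuclideanSpace ℝ (Fin 4)) ∈ V := by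
    intro x
    change Sq (1, θ (T, (x : EuclideanSpace ℝ (Fin 4)))) ∈ V
    rcases hend x.1 x.2.1 x.2.2 with ⟨hfix, hnot⟩ | ⟨hn2, hG⟩
    · rw [hfix]
      by_cases hxc : ‖(x : EuclideanSpace ℝ (Fin 4))‖ ≤ c
      · rw [hSqle 1 _ hxc]
        exact ⟨by simp only [mem_setOf_eq]; linarith, fun h => hnot (hclP h)⟩
      · push Not at hxc
        have hn := hSqnorm 1 zero_le_one le_rfl _ hxc
        have hx3 : ‖(x : EuclideanSpace ℝ (Fin 4))‖ < R + 3 := x.2.1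
        refine ⟨by simp only [mem_setOf_eq]; linarith, fun h => ?_⟩
        have := hP'n _ (hclP h)
        linarith
    · rw [hSqle 1 _ (by linarith)]
      exact ⟨by simp only [mem_setOf_eq]; linarith, fun h => absurd (hclP h).2 (not_le.2 hG)⟩
  -- the homotopies `id ≃ θ_T ≃ Φ`
  let ψ : C(U, U) := ⟨fun x => ⟨θ (T, (x : EuclideanSpace ℝ (Fin 4))), hstayU x T hT0⟩,
    (hθc.comp (continuous_const.prodMk continuous_subtype_val)).subtype_mk _⟩
  let H₁ : ContinuousMap.Homotopy (ContinuousMap.id U) ψ :=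
    { toFun := fun p => ⟨θ ((p.1 : ℝ) * T, (p.2 : EuclideanSpace ℝ (Fin 4))),
        hstayU p.2 _ (mul_nonneg p.1.2.1 hT0)⟩
      continuous_toFun := (hθc.comp ((continuous_subtype_val.comp continuous_fst).mul continuous_const
        |>.prodMk (continuous_subtype_val.comp continuous_snd))).subtype_mk _
      map_zero_left := fun x => by
        apply Subtype.ext
        simp [h0]
      map_one_left := fun x => by
        apply Subtype.ext
        simp [ψ] }
  let H₂ : ContinuousMap.Homotopy ψ Φ :=
    { toFun := fun p => ⟨Sq ((p.1 : ℝ), θ (T, (p.2 : EuclideanSpace ℝ (Fin 4)))),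
        hSqU p.1 p.1.2.1 p.1.2.2 _ (hstayU p.2 T hT0)⟩
      continuous_toFun := (hSqc.comp ((continuous_subtype_val.comp continuous_fst).prodMk
        (hθc.comp (continuous_const.prodMk (continuous_subtype_val.comp continuous_snd))))).subtype_mk _
      map_zero_left := fun x => by
        apply Subtype.ext
        simp [ψ, hSq0]
      map_one_left := fun x => by
        apply Subtype.ext
        rfl }
  exact ⟨V, Φ, hVo, hVc, hVU, hΦV, ⟨(H₁.trans H₂).symm⟩⟩

end FriendsH2

/-- **`H_q(ℝ⁴ | D_k; ℚ)` is finite-dimensional for `q = 2, 3`** (`D_k = MMSW.modelHandlebody k`,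
the model dotted handlebody `≅ ♮ᵏ(S¹ × B³)`; true values `0` and `k` by Alexander duality, not
needed): excision into the ball `B(0, R + 3)`, the long exact sequence of the pair, and finite
generation of `H_*(B(0, R + 3) ∖ D_k; ℚ)` by Wilder's principle (Bredon 1997, II.17) applied to the
deformation `FriendsH2.exists_deformation_ball_diff_modelHandlebody` (Milnor 1963, Thm. 3.1).
The registered helper of line `mk_friends` consumed by `helper_friendsH2_of_modelHandlebody_localHomology_finite`.
[cite: Milnor1963, Thm. 3.1] [cite: Bredon1997, §II.17 Thm. 17.4] [cite: HatcherAT2002, Thm. 2.16 and Thm. 2.20] -/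
theorem helper_modelHandlebody_localHomology_finite : ∀ k : ℕ, Module.Finite ℚ (Literature.AlgebraicTopology.SingularHomology.localHomologyOfSet ℚ ℚ (EuclideanSpace ℝ (Fin 4)) (Literature.Topology.FourManifolds.MMSW.modelHandlebody k) 2) ∧ Module.Finite ℚ (Literature.AlgebraicTopology.SingularHomology.localHomologyOfSet ℚ ℚ (EuclideanSpace ℝ (Fin 4)) (Literature.Topology.FourManifolds.MMSW.modelHandlebody k) 3) := by
  intro k
  obtain ⟨V, Φ, hV, hVc, hVU, hΦV, hΦ⟩ := FriendsH2.exists_deformation_ball_diff_modelHandlebody k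
  have hU : IsOpen {y : EuclideanSpace ℝ (Fin 4) | ‖y‖ < 40 * ((k : ℝ) + 1) + 3 ∧ y ∉ modelHandlebody k} :=
    (isOpen_lt continuous_norm continuous_const).inter (isClosed_modelHandlebody k).isOpen_compl
  have hfin : ∀ n : ℕ, Module.Finite ℚ (singularHomology ℚ ℚ
      ↥({y : EuclideanSpace ℝ (Fin 4) | ‖y‖ < 40 * ((k : ℝ) + 1) + 3 ∧ y ∉ modelHandlebody k}) n) :=
    fun n => FriendsH2.finite_singularHomology_of_deformation hU hV hVc hVU Φ hΦV hΦ n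
  have hρ : 40 * ((k : ℝ) + 1) + 1 < 40 * ((k : ℝ) + 1) + 3 := by linarith
  exact ⟨FriendsH2.finite_localHomologyOfSet_of_finite_compl k hρ (fun n _ _ => hfin n) le_rfl (by omega),
    FriendsH2.finite_localHomologyOfSet_of_finite_compl k hρ (fun n _ _ => hfin n) (by omega) le_rfl⟩

end Summit.SmoothPoincare4.SmoothPoincare4.Theorems.DcrGap.MkFriends

end
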